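import Mathlib
import Summits.Ventures.PercRepro2.TypedRow23
import Summits.Ventures.PercRepro2.OneTypedEdge

/-!
# (ROW-MIN), the type-1 base dominates the smaller of its deletion and its contraction, and the
full inductive certificate of row 2′TRI (blind cell PercRepro2, night-3 g19, 2026-08-28;
`proofs/NIGHT3-CERT.md` §28.5)

CANDIDATE (ROW-MIN), NOT claimed proved: for every typed edge `g` of type `1`,
`N(g := 1) ≥ min (N(g := pinned closed), N(g := pinned open))` — along every edge the Bernstein
row `(N₀, N₁, N₂, N₃)` is valley-free at `N₁`. Census (exact, this seat's random code): on
129,000-odd nonzero rows of 1.2 M random instances with `≤ 9` typed edges, `N₁ < N₀` on 6.5 % and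
`N₁ < N₃` on 2.4 % of the rows, NEVER both (0 failures); the exhaustive census on the abstract
model is kit j296355.

WHAT IT GIVES in the kernel, unconditionally on the candidates: with (ROW-23) (`TypedRow23.lean`)
EVERY typed edge reduces to a minor with one typed edge fewer — a type-`2` edge to its contraction,
a type-`1` edge to its deletion or its contraction — and the empty instance has `K₃(z, z, z) = 0`
(`K3_diag`), so

* `typedBases_of_row23_rowMin`: **row 2′TRI on every instance ⟸ (ROW-23) ∧ (ROW-MIN)** — the two
  candidates are an INDUCTIVE CERTIFICATE of the typed bases (each an inequality between the
  typed base of an instance and the typed base of a minor);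
* `HCov_of_row23_rowMin`: hence (HCOV) for every admissible weight vector.

`RowMin` is a `def` (Prop); the theorems are conditional on it and on `Row23`. Own work; standard
axioms.
-/

namespace Summit.Ventures.PercRepro2

open UnionCluster

namespace CovForm

section Defs

variable {V : Type*} {E : Type*} [Fintype E] [DecidableEq E] {R : Type*} [Field R]
  [LinearOrder R] [IsStrictOrderedRing R]

/-- **(ROW-MIN), a CANDIDATE (not claimed proved)**: with `g ∈ F` of type `1` (types in `{1, 2}` on
`F`), the typed base of `K₃` is at least the typed base with `g` pinned closed (type `0`) or at
least the typed base with `g` pinned open (type `3`). -/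
def RowMin (ends : E → Sym2 V) (o a₁ a₂ a₃ b : V) : Prop :=
  ∀ (F : Finset E) (z : Config E) (τ : E → ℕ) (g : E), g ∈ F → τ g = 1 →
    (∀ e ∈ F, τ e = 1 ∨ τ e = 2) →
    typedCount F z (Function.update τ g 0)
        (K3 ends o a₁ a₂ a₃ b : Config E → Config E → Config E → R) ≤
      typedCount F z τ (K3 ends o a₁ a₂ a₃ b) ∨
    typedCount F z (Function.update τ g 3)
        (K3 ends o a₁ a₂ a₃ b : Config E → Config E → Config E → R) ≤
      typedCount F z τ (K3 ends o a₁ a₂ a₃ b)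

end Defs

namespace Row23Red

open TypedRed OneTyped

section Main

variable {V : Type*} {E : Type*} [Fintype E] [DecidableEq E] {R : Type*} [Field R]
  [LinearOrder R] [IsStrictOrderedRing R]
variable (ends : E → Sym2 V) (o a₁ a₂ a₃ b : V)

omit [LinearOrder R] [IsStrictOrderedRing R] in
/-- A type-`0` edge is the deletion: the count with `g` of type `0` is the count on `F.erase g`
with `g` pinned closed. -/
lemma typedCount_update_zero (F : Finset E) (g : E) (hg : g ∈ F) (z : Config E) (τ : E → ℕ)
    (K : Config E → Config E → Config E → R) :
    typedCount F z (Function.update τ g 0) K =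
      typedCount (F.erase g) (Function.update z g false) τ K := by
  rw [typedCount_type_zero F g hg z (Function.update τ g 0) (Function.update_self _ _ _) K]
  exact typedCount_congr_τ (F.erase g) _ (fun e he => Function.update_of_ne (Finset.ne_of_mem_erase he) _ _) K

omit [IsStrictOrderedRing R] in
/-- **The induction step of (ROW-MIN)**: if both minors at a type-`1` edge `g` — the deletion and the
contraction — have nonnegative typed bases, so has the instance. -/
theorem typedCount_nonneg_of_rowMin_minors (hmin : RowMin (R := R) ends o a₁ a₂ a₃ b) (F : Finset E)
    (z : Config E) (τ : E → ℕ) (g : E) (hg : g ∈ F) (hg1 : τ g = 1)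
    (hτ : ∀ e ∈ F, τ e = 1 ∨ τ e = 2)
    (hdel : 0 ≤ typedCount (F.erase g) (Function.update z g false) τ
      (K3 ends o a₁ a₂ a₃ b : Config E → Config E → Config E → R))
    (hcon : 0 ≤ typedCount (F.erase g) (Function.update z g true) τ
      (K3 ends o a₁ a₂ a₃ b : Config E → Config E → Config E → R)) :
    0 ≤ typedCount F z τ (K3 ends o a₁ a₂ a₃ b : Config E → Config E → Config E → R) := by
  rcases hmin F z τ g hg hg1 hτ with h | h
  · rw [typedCount_update_zero F g hg z τ] at h
    exact le_trans hdel h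
  · rw [typedCount_update_three F g hg z τ] at h
    exact le_trans hcon h

omit [IsStrictOrderedRing R] in
/-- **Row 2′TRI from (ROW-23) and (ROW-MIN)**: every typed edge reduces to a minor with one typed
edge fewer, and the empty instance vanishes. -/
theorem typedBases_of_row23_rowMin (h23 : Row23 (R := R) ends o a₁ a₂ a₃ b)
    (hmin : RowMin (R := R) ends o a₁ a₂ a₃ b) : TypedBases (R := R) ends o a₁ a₂ a₃ b := by
  intro F
  induction F using Finset.strongInduction with
  | H F ih =>
    intro z τ hτ
    rcases Finset.eq_empty_or_nonempty F with rfl | ⟨g, hg⟩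
    · rw [typedCount_empty, K3_diag]
    · have hsub := Finset.erase_ssubset hg
      have hτ' : ∀ e ∈ F.erase g, τ e = 1 ∨ τ e = 2 := fun e he => hτ e (Finset.mem_of_mem_erase he)
      rcases hτ g hg with hg1 | hg2
      · exact typedCount_nonneg_of_rowMin_minors ends o a₁ a₂ a₃ b hmin F z τ g hg hg1 hτ
          (ih (F.erase g) hsub (Function.update z g false) τ hτ')
          (ih (F.erase g) hsub (Function.update z g true) τ hτ')
      · exact typedCount_nonneg_of_row23_minor ends o a₁ a₂ a₃ b h23 F z τ g hg hg2 hτ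
          (ih (F.erase g) hsub (Function.update z g true) τ hτ')

/-- **(HCOV) from (ROW-23) and (ROW-MIN)**, for every admissible weight vector. -/
theorem HCov_of_row23_rowMin (h23 : Row23 (R := R) ends o a₁ a₂ a₃ b)
    (hmin : RowMin (R := R) ends o a₁ a₂ a₃ b) (p : E → R) (hp : IsProbVec p) :
    HCov p ends o a₁ a₂ a₃ b :=
  HCov_of_typedBases ends o a₁ a₂ a₃ b (typedBases_of_row23_rowMin ends o a₁ a₂ a₃ b h23 hmin) p hp

end Main

end Row23Red

end CovForm

end Summit.Ventures.PercRepro2
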